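import Mathlib.Analysis.SpecialFunctions.Pow.Deriv
import Mathlib.MeasureTheory.Integral.IntervalIntegral.FundThmCalculus
import Literature.NumberTheory.Sieve.SieveFunctions
import HarnessLib

/-!
# The forward solution of the `β`-sieve system (method of steps)

Trunk `AntSieve` (topic `NumberTheory/Sieve`). For every dimension `κ`, parameter `β > 1` and
constant `A`, the initial value problem of the Rosser–Iwaniec `β`-sieve
[Greaves2001, §4.2.1 (1.1)–(1.3) with `B = 0`, `C = A`] —
`s^κ F(s) = A` on `(0, β + 1]`, `s^κ f(s) = 0` on `(0, β]`,
`(s^κ F(s))' = κ s^{κ−1} f(s − 1)` for `s > β + 1`, `(s^κ f(s))' = κ s^{κ−1} F(s − 1)` for `s > β` —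
has a solution `(F, f)` continuous on `(0, ∞)`, obtained by integrating step by step over the
intervals `(β + n, β + n + 1]` (the method of steps for delay-differential equations; for the
functions `f_n` of Rosser's sieve this is [Greaves2001, §4.1.3 (3.1)–(3.2)]: "these equations define
`f_n(s)` … because of reasoning exactly analogous to that applying to the equations for `T_n`").
This file CONSTRUCTS the solution (`BetaSieveForward.upper`, `BetaSieveForward.lower`) and PROVES
the initial values, the continuity and the two delay-differential equations. Whether the solution
is NORMALISED (`F, f = 1 + O(e^{−s})`, the remaining clauses of `IsBetaSieveSolution`) depends on
`β` (through the zeros of the adjoint `q_κ`) and is not addressed here; uniqueness is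
`IsBetaSieveSolution.unique_of_beta_eq` (file `SieveFunctions`).

## Main definitions and results

* `BetaSieveForward.step κ β A`, `BetaSieveForward.iter κ β A n` — the `n`-th method-of-steps
  iterate (exact on `(0, β + n]`, `iter_succ_fst_eq` / `iter_succ_snd_eq`);
  `BetaSieveForward.upper κ β A = F`, `BetaSieveForward.lower κ β A = f`.
* `upper_eq` (`F = A s^{−κ}` on `(0, β + 1]`), `lower_eq` (`f = 0` on `(0, β]`),
  `continuousOn_upper`, `continuousOn_lower`, `hasDerivAt_upper`, `hasDerivAt_lower` (for `β > 1`).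

## References

* [Greaves2001] G. Greaves, *Sieves in Number Theory*, Springer (2001), §4.2.1 (1.1)–(1.3);
  §4.1.3 (3.1)–(3.2).
-/

open Filter Asymptotics Set Topology MeasureTheory

noncomputable section

namespace Literature.NumberTheory.Sieve

namespace BetaSieveForward

variable (κ β A : ℝ)

/-- One step of the method of steps: from a pair `(F, f)` exact on `(0, β + n]` to the pair
`(s ↦ s^{−κ}(A + ∫_{β+1}^{max(β+1, s)} κ t^{κ−1} f(t − 1) dt), s ↦ s^{−κ} ∫_β^{max(β, s)} κ t^{κ−1} F(t − 1) dt)`,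
exact on `(0, β + n + 1]`. [folklore] -/
def step (g : (ℝ → ℝ) × (ℝ → ℝ)) : (ℝ → ℝ) × (ℝ → ℝ) :=
  (fun s => s ^ (-κ) * (A + ∫ t in (β + 1)..max (β + 1) s, κ * t ^ (κ - 1) * g.2 (t - 1)),
    fun s => s ^ (-κ) * ∫ t in β..max β s, κ * t ^ (κ - 1) * g.1 (t - 1))

/-- The `n`-th iterate of `step`, started from the initial data `(A s^{−κ}, 0)`: the solution on
`(0, β + n]`. [folklore] -/
def iter : ℕ → (ℝ → ℝ) × (ℝ → ℝ)
  | 0 => (fun s => A * s ^ (-κ), fun _ => 0)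
  | n + 1 => step κ β A (iter n)

/-- The upper function `F` of the forward solution (the iterate of index `⌈s⌉₊ + 1` at `s`).
[folklore] -/
def upper (s : ℝ) : ℝ :=
  (iter κ β A (⌈s⌉₊ + 1)).1 s

/-- The lower function `f` of the forward solution. [folklore] -/
def lower (s : ℝ) : ℝ :=
  (iter κ β A (⌈s⌉₊ + 1)).2 s

variable {κ β A}

/-- Unfolding of the first component of an iterate of positive index. [folklore] -/
theorem iter_succ_fst (n : ℕ) (s : ℝ) : (iter κ β A (n + 1)).1 s =
    s ^ (-κ) * (A + ∫ t in (β + 1)..max (β + 1) s, κ * t ^ (κ - 1) * (iter κ β A n).2 (t - 1)) :=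
  rfl

/-- Unfolding of the second component of an iterate of positive index. [folklore] -/
theorem iter_succ_snd (n : ℕ) (s : ℝ) : (iter κ β A (n + 1)).2 s =
    s ^ (-κ) * ∫ t in β..max β s, κ * t ^ (κ - 1) * (iter κ β A n).1 (t - 1) :=
  rfl

/-! ### Initial values -/

/-- Every iterate has `F(s) = A s^{−κ}` for `s ≤ β + 1`. [folklore] -/
theorem iter_fst_eq (n : ℕ) {s : ℝ} (hs : s ≤ β + 1) : (iter κ β A n).1 s = A * s ^ (-κ) := by
  cases n with
  | zero => rfl
  | succ n => rw [iter_succ_fst, max_eq_left hs, intervalIntegral.integral_same, add_zero, mul_comm]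

/-- Every iterate has `f(s) = 0` for `s ≤ β`. [folklore] -/
theorem iter_snd_eq (n : ℕ) {s : ℝ} (hs : s ≤ β) : (iter κ β A n).2 s = 0 := by
  cases n with
  | zero => rfl
  | succ n => rw [iter_succ_snd, max_eq_left hs, intervalIntegral.integral_same, mul_zero]

/-! ### Consistency of the iterates -/

/-- Consecutive iterates agree up to `β + n`. [folklore] -/
theorem iter_succ_eq (n : ℕ) : ∀ s : ℝ, s ≤ β + n →
    (iter κ β A (n + 1)).1 s = (iter κ β A n).1 s ∧
      (iter κ β A (n + 1)).2 s = (iter κ β A n).2 s := by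
  induction n with
  | zero =>
    intro s hs
    simp only [Nat.cast_zero, add_zero] at hs
    exact ⟨iter_fst_eq 1 (by linarith), by rw [iter_snd_eq 1 hs]; rfl⟩
  | succ n ih =>
    intro s hs
    simp only [Nat.cast_succ] at hs
    refine ⟨?_, ?_⟩
    · rw [iter_succ_fst, iter_succ_fst]
      congr 2
      refine intervalIntegral.integral_congr fun t ht => ?_
      have ht' : t ≤ max (β + 1) s := by
        rw [uIcc_of_le (le_max_left _ _)] at ht; exact ht.2
      have ht1 : t - 1 ≤ β + n := by
        have : max (β + 1) s ≤ β + n + 1 := max_le (by linarith) (by linarith)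
        linarith
      rw [(ih (t - 1) ht1).2]
    · rw [iter_succ_snd, iter_succ_snd]
      congr 1
      refine intervalIntegral.integral_congr fun t ht => ?_
      have ht' : t ≤ max β s := by
        rw [uIcc_of_le (le_max_left _ _)] at ht; exact ht.2
      have ht1 : t - 1 ≤ β + n := by
        have : max β s ≤ β + n + 1 := max_le (by linarith) (by linarith)
        linarith
      rw [(ih (t - 1) ht1).1]

/-- All iterates of index `≥ n` agree up to `β + n`. [folklore] -/
theorem iter_eq_of_le {n m : ℕ} (hnm : n ≤ m) {s : ℝ} (hs : s ≤ β + n) :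
    (iter κ β A m).1 s = (iter κ β A n).1 s ∧ (iter κ β A m).2 s = (iter κ β A n).2 s := by
  induction m, hnm using Nat.le_induction with
  | base => exact ⟨rfl, rfl⟩
  | succ m hnm ih =>
    have hs' : s ≤ β + m := hs.trans (by gcongr)
    exact ⟨(iter_succ_eq m s hs').1.trans ih.1, (iter_succ_eq m s hs').2.trans ih.2⟩

/-- `F` is the first component of every iterate of sufficiently large index. [folklore] -/
theorem upper_eq_iter (hβ : 0 ≤ β) {n : ℕ} {s : ℝ} (hs : s ≤ β + n) :
    upper κ β A s = (iter κ β A n).1 s := by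
  have hN : s ≤ β + (⌈s⌉₊ + 1 : ℕ) := by
    have := Nat.le_ceil s; push_cast; linarith
  rw [upper, ← (iter_eq_of_le (le_max_left (⌈s⌉₊ + 1) n) hN).1,
    (iter_eq_of_le (le_max_right (⌈s⌉₊ + 1) n) hs).1]

/-- `f` is the second component of every iterate of sufficiently large index. [folklore] -/
theorem lower_eq_iter (hβ : 0 ≤ β) {n : ℕ} {s : ℝ} (hs : s ≤ β + n) :
    lower κ β A s = (iter κ β A n).2 s := by
  have hN : s ≤ β + (⌈s⌉₊ + 1 : ℕ) := by
    have := Nat.le_ceil s; push_cast; linarith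
  rw [lower, ← (iter_eq_of_le (le_max_left (⌈s⌉₊ + 1) n) hN).2,
    (iter_eq_of_le (le_max_right (⌈s⌉₊ + 1) n) hs).2]

/-- **Initial value of `F`**: `F(s) = A s^{−κ}` for `0 < s ≤ β + 1` (indeed for all `s ≤ β + 1`).
[cite: Greaves2001, §4.2.1 (1.3)] -/
theorem upper_eq {s : ℝ} (hs : s ≤ β + 1) : upper κ β A s = A * s ^ (-κ) :=
  iter_fst_eq _ hs

/-- **Initial value of `f`**: `f(s) = 0` for `s ≤ β`. [cite: Greaves2001, §4.2.1 (1.3)] -/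
theorem lower_eq {s : ℝ} (hs : s ≤ β) : lower κ β A s = 0 :=
  iter_snd_eq _ hs

/-! ### Continuity -/

/-- The integrand `t ↦ κ t^{κ−1} φ(t − 1)` is continuous on `(1, ∞)` when `φ` is continuous on
`(0, ∞)`. [folklore] -/
theorem continuousOn_integrand (c : ℝ) {φ : ℝ → ℝ} (hφ : ContinuousOn φ (Ioi 0)) :
    ContinuousOn (fun t : ℝ => c * t ^ (c - 1) * φ (t - 1)) (Ioi 1) := by
  refine ContinuousOn.mul ?_ (hφ.comp (continuousOn_id.sub continuousOn_const) fun t ht => ?_)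
  · exact continuousOn_const.mul
      (continuousOn_id.rpow_const fun t (ht : 1 < t) => Or.inl (by simp only [id]; linarith))
  · simp only [mem_Ioi] at ht ⊢
    show 0 < id t - 1
    simp only [id]; linarith

/-- FTC for the primitive `b ↦ ∫_a^b g` of a function continuous on `(1, ∞)`, at `b > 1`, `a > 1`.
[folklore] -/
theorem hasDerivAt_primitive {g : ℝ → ℝ} (hg : ContinuousOn g (Ioi 1)) {a b : ℝ} (ha : 1 < a)
    (hb : 1 < b) : HasDerivAt (fun u => ∫ t in a..u, g t) (g b) b := by
  refine intervalIntegral.integral_hasDerivAt_right ?_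
    (hg.stronglyMeasurableAtFilter isOpen_Ioi b hb) (hg.continuousAt (Ioi_mem_nhds hb))
  refine (hg.mono fun t ht => ?_).intervalIntegrable
  rcases le_total a b with hab | hab
  · rw [uIcc_of_le hab] at ht; exact lt_of_lt_of_le ha ht.1
  · rw [uIcc_of_ge hab] at ht; exact lt_of_lt_of_le hb ht.1

/-- The clipped primitive `s ↦ ∫_a^{max(a, s)} g` is continuous (everywhere) for `g` continuous on
`(1, ∞)` and `a > 1`. [folklore] -/
theorem continuous_primitive_max {g : ℝ → ℝ} (hg : ContinuousOn g (Ioi 1)) {a : ℝ} (ha : 1 < a) :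
    Continuous fun s : ℝ => ∫ t in a..max a s, g t := by
  have h1 : ∀ u, 1 < u → ContinuousAt (fun u => ∫ t in a..u, g t) u := fun u hu =>
    (hasDerivAt_primitive hg ha hu).continuousAt
  refine continuous_iff_continuousAt.mpr fun s => ?_
  exact (h1 (max a s) (lt_of_lt_of_le ha (le_max_left _ _))).comp
    (continuous_const.max continuous_id).continuousAt

/-- Every iterate is continuous on `(0, ∞)` (for `β > 1`). [folklore] -/
theorem continuousOn_iter (hβ : 1 < β) : ∀ n : ℕ,
    ContinuousOn (iter κ β A n).1 (Ioi 0) ∧ ContinuousOn (iter κ β A n).2 (Ioi 0) := by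
  have hrpow : ContinuousOn (fun s : ℝ => s ^ (-κ)) (Ioi 0) :=
    continuousOn_id.rpow_const fun s (hs : 0 < s) => Or.inl (ne_of_gt hs)
  intro n
  induction n with
  | zero => exact ⟨continuousOn_const.mul hrpow, continuousOn_const⟩
  | succ n ih =>
    refine ⟨?_, ?_⟩
    · have hc := continuous_primitive_max (continuousOn_integrand κ ih.2) (by linarith : 1 < β + 1)
      exact hrpow.mul (continuousOn_const.add hc.continuousOn)
    · have hc := continuous_primitive_max (continuousOn_integrand κ ih.1) hβ
      exact hrpow.mul hc.continuousOn

/-- **`F` is continuous on `(0, ∞)`** (for `β > 1`). [cite: Greaves2001, §4.2.1 (1.1)–(1.3)] -/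
theorem continuousOn_upper (hβ : 1 < β) : ContinuousOn (upper κ β A) (Ioi 0) := by
  intro s₀ hs₀
  obtain ⟨n, hn⟩ := exists_nat_gt (s₀ - β)
  have hU : Ioo 0 (β + n) ∈ 𝓝 s₀ := Ioo_mem_nhds hs₀ (by linarith)
  have heq : upper κ β A =ᶠ[𝓝 s₀] (iter κ β A n).1 := by
    filter_upwards [hU] with s hs
    exact upper_eq_iter (by linarith) hs.2.le
  have hc : ContinuousAt (iter κ β A n).1 s₀ :=
    ((continuousOn_iter hβ n).1.continuousAt (Ioi_mem_nhds hs₀))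
  exact (hc.congr_of_eventuallyEq heq).continuousWithinAt

/-- **`f` is continuous on `(0, ∞)`** (for `β > 1`). [cite: Greaves2001, §4.2.1 (1.1)–(1.3)] -/
theorem continuousOn_lower (hβ : 1 < β) : ContinuousOn (lower κ β A) (Ioi 0) := by
  intro s₀ hs₀
  obtain ⟨n, hn⟩ := exists_nat_gt (s₀ - β)
  have hU : Ioo 0 (β + n) ∈ 𝓝 s₀ := Ioo_mem_nhds hs₀ (by linarith)
  have heq : lower κ β A =ᶠ[𝓝 s₀] (iter κ β A n).2 := by
    filter_upwards [hU] with s hs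
    exact lower_eq_iter (by linarith) hs.2.le
  have hc : ContinuousAt (iter κ β A n).2 s₀ :=
    ((continuousOn_iter hβ n).2.continuousAt (Ioi_mem_nhds hs₀))
  exact (hc.congr_of_eventuallyEq heq).continuousWithinAt

/-! ### The delay-differential equations -/

/-- The `f`-equation for the iterates: `(t^κ f_{n+1}(t))' = κ s^{κ−1} F_n(s − 1)` at `s > β`.
[folklore] -/
theorem hasDerivAt_iter_snd (hβ : 1 < β) (n : ℕ) {s : ℝ} (hs : β < s) :
    HasDerivAt (fun t : ℝ => t ^ κ * (iter κ β A (n + 1)).2 t)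
      (κ * s ^ (κ - 1) * (iter κ β A n).1 (s - 1)) s := by
  have hg := continuousOn_integrand κ (continuousOn_iter (κ := κ) (A := A) hβ n).1
  have hP := hasDerivAt_primitive hg hβ (hβ.trans hs)
  refine hP.congr_of_eventuallyEq ?_
  filter_upwards [Ioi_mem_nhds hs] with t (ht : β < t)
  have ht0 : 0 < t := by linarith
  rw [iter_succ_snd, max_eq_right ht.le, ← mul_assoc, ← Real.rpow_add ht0, add_neg_cancel,
    Real.rpow_zero, one_mul]

/-- The `F`-equation for the iterates: `(t^κ F_{n+1}(t))' = κ s^{κ−1} f_n(s − 1)` at `s > β + 1`.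
[folklore] -/
theorem hasDerivAt_iter_fst (hβ : 1 < β) (n : ℕ) {s : ℝ} (hs : β + 1 < s) :
    HasDerivAt (fun t : ℝ => t ^ κ * (iter κ β A (n + 1)).1 t)
      (κ * s ^ (κ - 1) * (iter κ β A n).2 (s - 1)) s := by
  have hg := continuousOn_integrand κ (continuousOn_iter (κ := κ) (A := A) hβ n).2
  have hP := (hasDerivAt_primitive hg (by linarith : 1 < β + 1) (by linarith : 1 < s)).const_add A
  refine hP.congr_of_eventuallyEq ?_
  filter_upwards [Ioi_mem_nhds hs] with t (ht : β + 1 < t)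
  have ht0 : 0 < t := by linarith
  rw [iter_succ_fst, max_eq_right ht.le, ← mul_assoc, ← Real.rpow_add ht0, add_neg_cancel,
    Real.rpow_zero, one_mul]

/-- **The `f`-equation** `(s^κ f(s))' = κ s^{κ−1} F(s − 1)` for `s > β` (`β > 1`).
[cite: Greaves2001, §4.2.1 (1.2)] -/
theorem hasDerivAt_lower (hβ : 1 < β) {s : ℝ} (hs : β < s) :
    HasDerivAt (fun t : ℝ => t ^ κ * lower κ β A t)
      (κ * s ^ (κ - 1) * upper κ β A (s - 1)) s := by
  obtain ⟨n, hn⟩ := exists_nat_gt (s - β)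
  have h1 := hasDerivAt_iter_snd (A := A) (κ := κ) hβ n hs
  rw [← upper_eq_iter (by linarith) (by linarith : s - 1 ≤ β + n)] at h1
  refine h1.congr_of_eventuallyEq ?_
  filter_upwards [Iio_mem_nhds (by linarith : s < β + n)] with t (ht : t < β + n)
  rw [lower_eq_iter (by linarith) (by push_cast; linarith : t ≤ β + (n + 1 : ℕ))]

/-- **The `F`-equation** `(s^κ F(s))' = κ s^{κ−1} f(s − 1)` for `s > β + 1` (`β > 1`).
[cite: Greaves2001, §4.2.1 (1.1)] -/
theorem hasDerivAt_upper (hβ : 1 < β) {s : ℝ} (hs : β + 1 < s) :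
    HasDerivAt (fun t : ℝ => t ^ κ * upper κ β A t)
      (κ * s ^ (κ - 1) * lower κ β A (s - 1)) s := by
  obtain ⟨n, hn⟩ := exists_nat_gt (s - β)
  have h1 := hasDerivAt_iter_fst (A := A) (κ := κ) hβ n hs
  rw [← lower_eq_iter (by linarith) (by linarith : s - 1 ≤ β + n)] at h1
  refine h1.congr_of_eventuallyEq ?_
  filter_upwards [Iio_mem_nhds (by linarith : s < β + n)] with t (ht : t < β + n)
  rw [upper_eq_iter (by linarith) (by push_cast; linarith : t ≤ β + (n + 1 : ℕ))]

/-! ### Summary -/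

/-- **The forward solution** (`β > 1`): `(F, f) = (upper κ β A, lower κ β A)` satisfies the initial
conditions, the two delay-differential equations and the continuity clauses of
`IsBetaSieveSolution κ F f β A` [Greaves2001, §4.2.1 (1.1)–(1.3) with `B = 0`, `C = A`]; the
normalisation clauses are NOT asserted. [cite: Greaves2001, §4.2.1 (1.1)–(1.3)] -/
theorem isForwardSolution (hβ : 1 < β) :
    (∀ s ∈ Ioc 0 (β + 1), upper κ β A s = A * s ^ (-κ)) ∧ (∀ s ∈ Ioc 0 β, lower κ β A s = 0) ∧
      (∀ s : ℝ, β + 1 < s → HasDerivAt (fun t : ℝ => t ^ κ * upper κ β A t)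
        (κ * s ^ (κ - 1) * lower κ β A (s - 1)) s) ∧
      (∀ s : ℝ, β < s → HasDerivAt (fun t : ℝ => t ^ κ * lower κ β A t)
        (κ * s ^ (κ - 1) * upper κ β A (s - 1)) s) ∧
      ContinuousOn (upper κ β A) (Ioi 0) ∧ ContinuousOn (lower κ β A) (Ioi 0) :=
  ⟨fun _ hs => upper_eq hs.2, fun _ hs => lower_eq hs.2, fun _ hs => hasDerivAt_upper hβ hs,
    fun _ hs => hasDerivAt_lower hβ hs, continuousOn_upper hβ, continuousOn_lower hβ⟩

/-- The forward solution is a `β`-sieve solution in the sense of `IsBetaSieveSolution` as soon as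
`A > 0` and it is normalised (`F, f = 1 + O(e^{−s})`); the normalisation is the only clause that
depends on the choice of `β > 1`. [folklore] -/
theorem isBetaSieveSolution (hβ : 1 < β) (hA : 0 < A)
    (hF : (fun s : ℝ => upper κ β A s - 1) =O[atTop] fun s : ℝ => Real.exp (-s))
    (hf : (fun s : ℝ => lower κ β A s - 1) =O[atTop] fun s : ℝ => Real.exp (-s)) :
    IsBetaSieveSolution κ (upper κ β A) (lower κ β A) β A where
  one_le := hβ.le
  pos := hA
  upper_eq := fun _ hs => upper_eq hs.2
  lower_eq := fun _ hs => lower_eq hs.2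
  hasDerivAt_upper := fun _ hs => hasDerivAt_upper hβ hs
  hasDerivAt_lower := fun _ hs => hasDerivAt_lower hβ hs
  continuousOn_upper := continuousOn_upper hβ
  continuousOn_lower := continuousOn_lower hβ
  upper_isBigO := hF
  lower_isBigO := hf

end BetaSieveForward

end Literature.NumberTheory.Sieve
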